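import Literature.AnabelianGeometry.EtaleTheta.LogDivisorModelTateTowerThetaGalois
import Mathlib.GroupTheory.OrderOfElement

/-!
# [EtTh] Def. 3.1 / Prop. 3.2: a Kummer LEVEL of the `Ÿ`-skeleton with cusps and theta — torsion constants `μ` RECORDED in the
# function group (Tate tower v3, piece 2a — class (b) NV)

S. Mochizuki, *The étale theta function …*, Publ. RIMS **45** (2009) [MochizukiEtTh2009], §3 Def. 3.1 / Prop. 3.2 (PRIMS p.70),
§1 p.13 («`K_N := K(ζ_N, q_X^{1/N})`»: the base field of the Kummer coverings contains the roots of unity), Prop. 1.4 p.21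
[cite: MochizukiEtTh2009, Def 3.1 p.70].

CLASS (b) MODEL / NON-VACUITY WITNESS (abc-iut cell, layer L2; seat abc-iut-L2-t3 (gen 7), row «TATE TOWER v3» piece 2 of
abc-iut-L2-lead R812 («constant field / per-level roots over this skeleton»), file 2a = the LEVEL DATUM).  It is abc-iut-L2-d2's
ζ-twist piece (a) `TateTowerTwist.model A` (p475299: `Fn = μ × ⟨ϖ_m⟩ × ⟨U_m⟩` over the chain-only skeleton `TateTower.model`) with
the chain-only skeleton replaced by THIS seat's `Ÿ`-skeleton WITH CUSPS AND `Θ̈` (`TateTowerTheta.model`, p476816) — every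
log-divisor field of `TateTowerTheta.model` consumed BY NAME, nothing restated:
* for a FINITE commutative group `A` («`μ`», the roots of unity of the level), **`TateTowerThetaTwist.model A`**: functions
  `Fn := A × (μ₂ × ⟨ϖ̈_m⟩ × ⟨Ü_m⟩ × ⟨Θ̈_m⟩)`, divisor through the skeleton (`(ζ, f) ↦ div f`: `F_j ↦ c + k·j − t·j²`, cusp ↦ `t`;
  TRIVIAL on `μ`), constants `μ × μ₂ × ⟨ϖ̈_m⟩`, integral constants `μ × μ₂ × ϖ̈_m^ℕ`; Prop. 3.2 (ii) with content
  (`TateTowerTheta.divFun_nonneg_iff`), Prop. 3.2 (iii) (`μ` finite — roots of unity must GROW along the tower — and the skeleton);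
  `divisor_eq_one_iff`; the cusp laws (`cuspLaws`);
* `isOfFinOrder_iff`: the torsion of `Fn` is EXACTLY `μ × μ₂` (roots of unity RECORDED); `theta`, `coordU` are not constants,
  `zeta ζ`, `unif` are.
The level carries the SAME cusp/theta divisor skeleton at every `μ` (the divisor formula is level-independent in level units,
`ord ϖ̈_m = 1`: VNEXT memo `VNEXT-V3-CuspTheta-L2t3.md` §2), so the towers of the ζ-twist row (abc-iut-L2-d2 p478618 over
abc-iut-L1-t6's `Compat`) can be re-run over it; the Galois ACTION at a level (how the Kummer coordinates twist `Θ̈_m`: trivially,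
or through a third Kummer coordinate recording the mod-`N` étale theta class) is a census decision (piece 2b), NOT made here.
HONEST LABEL: a combinatorial design model (finite roots of unity adjoined to the `Ÿ`-skeleton), NOT the formal scheme; defs +
theorems only, no Prop-valued fact, no instance, no notation, no sorry; nothing here bears on [IUTchIII] Cor. 3.12; no side
taken; typed ≠ proved.
-/

noncomputable section

namespace Literature.AnabelianGeometry.EtaleTheta

open CategoryTheory

namespace LogDivisorModel

namespace TateTowerThetaTwist

open TateTowerTheta

variable (A : Type) [CommGroup A]

/-! ## The level datum `μ × (μ₂ × ⟨ϖ̈_m⟩ × ⟨Ü_m⟩ × ⟨Θ̈_m⟩)` over the `Ÿ`-skeleton -/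

/-- The nonzero meromorphic functions of a Kummer level of the `Ÿ`-tower: `μ × Fn(Ÿ-skeleton)` — `μ = A` the roots of unity
recorded at this level, then `(−1)^ε ϖ̈_m^c Ü_m^k Θ̈_m^t` (roots of the skeleton's functions). [cite: MochizukiEtTh2009, Def 3.1 p.70] -/
abbrev Fn : Type := A × TateTowerTheta.model.Fn

/-- The skeleton part `(ζ, f) ↦ f`. [cite: MochizukiEtTh2009, Def 3.1 p.70] -/
abbrev skel : Fn A →* TateTowerTheta.model.Fn := MonoidHom.snd A _

/-- A root of unity `ζ ∈ μ` as a function of the level. [cite: MochizukiEtTh2009, Def 3.1 p.70] -/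
def zeta (ζ : A) : Fn A := (ζ, 1)
/-- The root `ϖ̈_m` of the uniformiser. [cite: MochizukiEtTh2009, Def 3.1 p.70] -/
def unif : Fn A := (1, TateTowerTheta.unif)
/-- The root `Ü_m` of the coordinate. [cite: MochizukiEtTh2009, Prop 1.4 p.21] -/
def coordU : Fn A := (1, TateTowerTheta.coordU)
/-- The root `Θ̈_m` of the theta function. [cite: MochizukiEtTh2009, Prop 1.4 p.21] -/
def theta : Fn A := (1, TateTowerTheta.theta)

variable [Finite A]

/-- **A Kummer level of the `Ÿ`-tower as an inhabitant of the Def. 3.1 / Prop. 3.2 interface** (every field proved): log-divisors,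
effectivity, Cartier-ness, cusps/components and multiplicities = the `Ÿ`-skeleton `TateTowerTheta.model` BY NAME; functions
`μ × Fn(skeleton)`, divisor through the skeleton (trivial on `μ`); constants `μ × μ₂ × ⟨ϖ̈_m⟩`; Prop. 3.2 (ii)(iii) proved.
[cite: MochizukiEtTh2009, Def 3.1 p.70] -/
def model : LogDivisorModel.{0} where
  Fn := Fn A
  DIV := TateTowerTheta.model.DIV
  DIVplus := TateTowerTheta.model.DIVplus
  Div := TateTowerTheta.model.Div
  exists_div_eq := TateTowerTheta.model.exists_div_eq
  eq_one_of_mem_of_inv_mem := TateTowerTheta.model.eq_one_of_mem_of_inv_mem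
  nonCuspidal := TateTowerTheta.model.nonCuspidal
  cuspidal := TateTowerTheta.model.cuspidal
  nonCuspidal_isCompl_cuspidal := TateTowerTheta.model.nonCuspidal_isCompl_cuspidal
  logMero := ⊤
  divisor := (TateTowerTheta.divHom.comp (skel A)).comp (Subgroup.subtype ⊤)
  divisor_mem_Div _ := trivial
  const := TateTowerTheta.constants.comap (skel A)
  const_le_logMero := le_top
  intConst := TateTowerTheta.intConstants.comap (skel A)
  intConst_le_const := fun _ hf => ⟨hf.2.1, hf.2.2⟩
  temperedMero := ⊤
  temperedMero_le_logMero := le_rfl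
  exists_pow_mem_Div := TateTowerTheta.model.exists_pow_mem_Div
  Cusp := TateTowerTheta.model.Cusp
  Comp := TateTowerTheta.model.Comp
  divPlusEquiv := TateTowerTheta.model.divPlusEquiv
  divPlusEquiv_nonCuspidal := TateTowerTheta.model.divPlusEquiv_nonCuspidal
  mem_intConst_of_divisor_mem f hf :=
    TateTowerTheta.model.mem_intConst_of_divisor_mem ⟨f.1.2, Subgroup.mem_top _⟩ hf
  divisor_mem_of_mem_intConst f hf :=
    TateTowerTheta.model.divisor_mem_of_mem_intConst ⟨f.1.2, Subgroup.mem_top _⟩ hf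
  divisor_eq_one_iff f := TateTowerTheta.model.divisor_eq_one_iff ⟨f.1.2, Subgroup.mem_top _⟩
  eq_one_of_forall_exists_pow_eq f hf := by
    -- an infinitely divisible element of `μ × Fn(skeleton)` is trivial: the skeleton by Prop. 3.2 (iii) there, `μ` because it is finite
    have h2 : f.2 = 1 := TateTowerTheta.model.eq_one_of_forall_exists_pow_eq f.2 fun N => by
      obtain ⟨g, hg⟩ := hf N
      exact ⟨g.2, by rw [← Prod.pow_snd, hg]⟩
    have h1 : f.1 = 1 := by
      haveI : Nonempty A := ⟨1⟩
      obtain ⟨g, hg⟩ := hf ⟨Nat.card A, Nat.card_pos⟩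
      have e := congrArg Prod.fst hg
      rw [Prod.pow_fst, PNat.mk_coe, pow_card_eq_one'] at e
      exact e.symm
    exact Prod.ext h1 h2

/-- The divisor of a function of the level is the skeleton divisor of its skeleton part (the root-of-unity factor has trivial
divisor). [cite: MochizukiEtTh2009, Def 3.1 p.70] -/
theorem divisor_apply (f : (model A).logMero) : (model A).divisor f = TateTowerTheta.divHom f.1.2 := rfl

/-- The divisor on multiplicities: `F_j ↦ c + k·j − t·j²`, cusp ↦ `t`. [cite: MochizukiEtTh2009, Prop 1.4 p.21] -/
theorem toAdd_divisor (f : (model A).logMero) (x : TateTowerTheta.Idx) :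
    Multiplicative.toAdd ((model A).divisor f) x = divFun (Multiplicative.toAdd f.1.2) x := rfl

/-- Constants of the level: `(ζ, f) ∈ L^×` iff the `Ü`- and `Θ̈`-exponents of `f` vanish. [cite: MochizukiEtTh2009, Def 3.1 p.70] -/
theorem mem_const_iff (f : Fn A) :
    f ∈ (model A).const ↔ eU (Multiplicative.toAdd f.2) = 0 ∧ eT (Multiplicative.toAdd f.2) = 0 := Iff.rfl

/-- Every root of unity `ζ ∈ μ` is a constant. [cite: MochizukiEtTh2009, Def 3.1 p.70] -/
theorem zeta_mem_const (ζ : A) : zeta A ζ ∈ (model A).const := ⟨rfl, rfl⟩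

/-- `ϖ̈_m` is a constant. [cite: MochizukiEtTh2009, Def 3.1 p.70] -/
theorem unif_mem_const : unif A ∈ (model A).const := ⟨rfl, rfl⟩

/-- `Ü_m` is NOT a constant. [cite: MochizukiEtTh2009, Prop 1.4 p.21] -/
theorem coordU_not_mem_const : coordU A ∉ (model A).const := fun h => one_ne_zero h.1

/-- `Θ̈_m` is NOT a constant. [cite: MochizukiEtTh2009, Prop 1.4 p.21] -/
theorem theta_not_mem_const : theta A ∉ (model A).const := fun h => one_ne_zero h.2

/-- The divisor of `Θ̈_m` is the skeleton's `div Θ̈ = (all cusps, multiplicity 1) − D_1` (level units). [cite: MochizukiEtTh2009, Prop 1.4 p.21] -/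
theorem divisor_theta :
    (model A).divisor ⟨theta A, Subgroup.mem_top _⟩ = (thetaZeros : TateTowerTheta.model.DIV) / (thetaPoles : TateTowerTheta.model.DIV) :=
  TateTowerTheta.divisor_theta

/-! ## The torsion of the level is exactly `μ × μ₂` -/

/-- A skeleton function has finite order iff its three exponents vanish (its torsion is the sign `μ₂`).
[cite: MochizukiEtTh2009, Def 3.1 p.70] -/
theorem isOfFinOrder_skel_iff (f : Multiplicative Exp) :
    IsOfFinOrder f ↔ eC (Multiplicative.toAdd f) = 0 ∧ eU (Multiplicative.toAdd f) = 0 ∧ eT (Multiplicative.toAdd f) = 0 := by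
  constructor
  · intro h
    obtain ⟨n, hn, hfn⟩ := h.exists_pow_eq_one
    have e := congrArg (fun u : Multiplicative Exp => Multiplicative.toAdd u) hfn
    simp only [toAdd_pow, toAdd_one] at e
    have eC' : n * eC (Multiplicative.toAdd f) = 0 := by
      have := congrArg eC e; simpa [eC, nsmul_eq_mul] using this
    have eU' : n * eU (Multiplicative.toAdd f) = 0 := by
      have := congrArg eU e; simpa [eU, nsmul_eq_mul] using this
    have eT' : n * eT (Multiplicative.toAdd f) = 0 := by
      have := congrArg eT e; simpa [eT, nsmul_eq_mul] using this
    have hn' : (n : ℤ) ≠ 0 := by exact_mod_cast hn.ne'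
    exact ⟨(mul_eq_zero.mp eC').resolve_left hn', (mul_eq_zero.mp eU').resolve_left hn', (mul_eq_zero.mp eT').resolve_left hn'⟩
  · rintro ⟨hc, hk, ht⟩
    refine isOfFinOrder_iff_pow_eq_one.2 ⟨2, two_pos, Multiplicative.toAdd.injective ?_⟩
    rw [toAdd_pow, toAdd_one]
    refine ext_exp ?_ ?_ ?_ ?_
    · change 2 • (Multiplicative.toAdd f).1 = 0
      rw [nsmul_eq_mul, Nat.cast_ofNat, show (2 : ZMod 2) = 0 from rfl, zero_mul]
    · change 2 • eC (Multiplicative.toAdd f) = 0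
      rw [hc, smul_zero]
    · change 2 • eU (Multiplicative.toAdd f) = 0
      rw [hk, smul_zero]
    · change 2 • eT (Multiplicative.toAdd f) = 0
      rw [ht, smul_zero]

/-- **Roots of unity are RECORDED**: a function of the level has finite order iff its skeleton exponents vanish, i.e. iff it
lies in `μ × μ₂`. [cite: MochizukiEtTh2009, Def 3.1 p.70] -/
theorem isOfFinOrder_iff (f : Fn A) :
    IsOfFinOrder f ↔ eC (Multiplicative.toAdd f.2) = 0 ∧ eU (Multiplicative.toAdd f.2) = 0 ∧ eT (Multiplicative.toAdd f.2) = 0 :=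
  Iff.trans ⟨fun h => h.snd, fun h => (isOfFinOrder_of_finite f.1).prod_mk h⟩ (isOfFinOrder_skel_iff f.2)

/-- Torsion functions have trivial divisor (they are units of `O`). [cite: MochizukiEtTh2009, Prop 3.2 p.70] -/
theorem divisor_eq_one_of_isOfFinOrder (f : Fn A) (h : IsOfFinOrder f) : (model A).divisor ⟨f, Subgroup.mem_top _⟩ = 1 := by
  obtain ⟨hc, hk, ht⟩ := (isOfFinOrder_iff A f).1 h
  refine Multiplicative.toAdd.injective (funext fun x => ?_)
  change divFun (Multiplicative.toAdd f.2) x = 0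
  rcases x with c | j
  · rw [divFun_inl, ht]
  · rw [divFun_inr, hc, hk, ht]; ring

/-! ## Cusp laws; the two halves of `div Θ̈_m` at the level -/

/-- The tacit cusp laws of Def. 3.1 (i) hold at the level (the skeleton's `TateTowerTheta.cuspLaws`, same log-divisors).
[cite: MochizukiEtTh2009, Def 3.1 p.70] -/
theorem cuspLaws : (model A).CuspLaws where
  cuspidal_le_Div := fun _ _ => trivial
  mem_cuspidal_iff d := TateTowerTheta.cuspLaws.mem_cuspidal_iff d

/-- The zero divisor of `Θ̈_m` (all cusps, multiplicity `1`) is a cuspidal effective log-divisor of the level.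
[cite: MochizukiEtTh2009, Prop 1.4 p.21] -/
theorem thetaZeros_mem_cuspidal : (thetaZeros : TateTowerTheta.model.DIVplus).1 ∈ (model A).cuspidal :=
  TateTowerTheta.thetaZeros_mem_cuspidal

/-- The polar divisor `D_1` is a non-cuspidal Cartier log-divisor of the level. [cite: MochizukiEtTh2009, Prop 1.4 p.21] -/
theorem thetaPoles_mem_nonCuspidal :
    (thetaPoles : TateTowerTheta.model.DIVplus).1 ∈ (model A).nonCuspidal ∧
      (thetaPoles : TateTowerTheta.model.DIVplus).1 ∈ (model A).Div :=
  TateTowerTheta.thetaPoles_mem_nonCuspidal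

/-- **Non-vacuity at a genuinely cyclotomic level**: with `μ = ℤ/n` (`n ≥ 1`) the interface is inhabited with `n`-torsion
constants AND cusps AND theta. [cite: MochizukiEtTh2009, Def 3.1 p.70] -/
theorem nonempty_model (n : ℕ) [NeZero n] : Nonempty LogDivisorModel.{0} := ⟨model (Multiplicative (ZMod n))⟩

end TateTowerThetaTwist

end LogDivisorModel

end Literature.AnabelianGeometry.EtaleTheta

end
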